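import Literature.NumberTheory.Automorphic.ArchExpIdeleGLOne
import Literature.NumberTheory.Automorphic.GLOneArchParameterClauses
import Mathlib.NumberTheory.NumberField.InfinitePlace.Ramification
import HarnessLib

/-!
# Base change for `GL₁` at the archimedean places: the differential of `χ_π ∘ N_{E/F}` place by place

Topic `NumberTheory/Automorphic`; proof file (theorems only: no definition, no named fact, no
instance), eighth step of the rank-one case of the named fact
`ArthurClozel1989_strongLifting_archimedean` (`BaseChangeArchimedean`; Arthur–Clozel (1989), Ch. 3,
Thm. 5.1 with Ch. 1 §7: for `GL(1)` and `ℂ/ℝ` the archimedean base change is `ξ ↦ ξ ∘ N`, i.e.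
"restriction on the Weil group side"). Sequel of `ArchExpIdeleGLOne`.

The setting is abstracted from the automorphic one (`AutomorphicRepsGLOneHeckeCharacter`): two Hecke
characters `χ_π` of `F` and `χ_Π` of `E` (`E/F` Galois) and two real linear forms `d_π` on
`𝔤𝔩₁(F_∞)`, `d_Π` on `𝔤𝔩₁(E_∞)` with `χ(det (exp Y, 1)) = e^{d(Y)}` (the differentials), such that
`χ_Π` is `Gal(E/F)`-invariant and `χ_Π(x_E) = χ_π(x)^{[E:F]}` on base-changed ideles — both hold for
`χ_Π = χ_π ∘ N_{E/F}` (`AdeleRing.ideleRelNorm_smul`, `AdeleRing.ideleRelNorm_ideleBaseChange`). From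
the idelic identities of `ArchExpIdeleGLOne` and the injectivity of `t ↦ e^{tμ}`
(`eq_of_forall_cexp_mul_eq` of `GLOneArchParameterClauses`) we get, for a place `w` of `E` above `v`:

* `dP_realPlace_smul`, `dP_complexPlace_smul_or`, `dP_complexPlace_conj_of_isReal_comap` — Galois
  transport of `d_Π` between the places above `v`, and conjugation invariance at a complex `w` over a
  real `v` (the decomposition group acts on `E_w = ℂ` by conjugation);
* `dP_baseChange_realPlace`, `dP_baseChange_complexPlace` — the base-change identity summed over
  the places above `v`, `d_Π((y_v)_E) = [E:F] d_π(y_v)`, and `linearMap_smul_one_eq_sum` — its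
  left side place by place;
* `card_filter_comap_mul_card_stabilizer` — `#{w ∣ v} · #Stab(w) = [E:F]` (orbit–stabiliser), with
  the three specialisations (real/real, complex/real, complex/complex);
* `embedding_comp_eq_iff_of_smul_eq`, `embedding_comp_eq_iff_not_of_smul_eq_conj` — which
  embedding of `F_v` the transported place extends;
* hence **`dP_realPlaceLie_eq`** (`w` real: `d_Π(r·1_w) = d_π(r·1_v)`),
  **`dP_complexPlaceLie_ofReal_eq`** (`w` complex, `v` real: `d_Π(r_w) = 2 d_π(r·1_v)`; with
  `dP_complexPlace_conj_of_isReal_comap`, `d_Π(ā_w) = d_Π(a_w)`),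
  **`dP_complexPlaceLie_eq_of_isComplex`** (`w`, `v` complex: `d_Π(b_w) = d_π(b_v)` or
  `d_Π(b̄_w) = d_π(b_v)` according as `σ_w|_F = σ_v` or `σ̄_v`): the differential of
  `Θ_{Π_w} = Θ_{π_v} ∘ N_{E_w/F_v}`.

## References

* J. Arthur, L. Clozel, Ann. of Math. Stud. 120 (1989), Ch. 1 §7, Ch. 3 Thm. 5.1 [ArthurClozelAMS120].
* J. W. S. Cassels, A. Fröhlich (eds.), *Algebraic Number Theory* (1967), Ch. VII (Tate) §1.1
  [CasselsFrohlichANT1967].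
-/

noncomputable section

open scoped MatrixGroups Matrix Classical ComplexConjugate
open NumberField NumberField.InfinitePlace NumberField.mixedEmbedding IsDedekindDomain

namespace Literature.NumberTheory.Automorphic

open Literature.NumberTheory.GaloisRepresentations

/-! ### Galois transport of the exponential ideles at a complex place, uniformly in the coordinate -/

section Galois

variable (F E : Type) [Field F] [Field E] [NumberField E] [Algebra F E]

/-- **`σ • γ_E(a_w) = γ_E(a_{σ w})` for all `a`, or `σ • γ_E(a_w) = γ_E(ā_{σ w})` for all `a`**,
according as `σ_{σw} ∘ σ = σ_w` or `σ̄_w` on `E` (the case depends only on `σ` and the complex place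
`w`: the transport `σ_w : E_w → E_{σw}` followed by the embedding of `σ w` is the embedding of `w`
or its conjugate). Refines `smul_det_ofInfinite_expGL_complexPlace`. [folklore] -/
theorem smul_det_ofInfinite_expGL_complexPlace_forall (σ : E ≃ₐ[F] E)
    (w : {w : InfinitePlace E // w.IsComplex}) :
    ((∀ x : E, (σ • w.1).embedding (σ x) = w.1.embedding x) ∧
      ∀ a : ℂ, σ • Matrix.GeneralLinearGroup.det (GLn.ofInfinite 1 E
          (expGL (complexPlaceLie 1 w (a • (1 : Matrix (Fin 1) (Fin 1) ℂ))))) =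
        Matrix.GeneralLinearGroup.det (GLn.ofInfinite 1 E
          (expGL (complexPlaceLie 1 ⟨σ • w.1, (isComplex_smul_iff).2 w.2⟩
            (a • (1 : Matrix (Fin 1) (Fin 1) ℂ)))))) ∨
    ((∀ x : E, (σ • w.1).embedding (σ x) = conj (w.1.embedding x)) ∧
      ∀ a : ℂ, σ • Matrix.GeneralLinearGroup.det (GLn.ofInfinite 1 E
          (expGL (complexPlaceLie 1 w (a • (1 : Matrix (Fin 1) (Fin 1) ℂ))))) =
        Matrix.GeneralLinearGroup.det (GLn.ofInfinite 1 E
          (expGL (complexPlaceLie 1 ⟨σ • w.1, (isComplex_smul_iff).2 w.2⟩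
            (conj a • (1 : Matrix (Fin 1) (Fin 1) ℂ)))))) := by
  have hcoord : ∀ (a' : ℂ) (w' : InfinitePlace E), Completion.extensionEmbedding (σ⁻¹ • w')
      ((((Matrix.GeneralLinearGroup.det (GLn.ofInfinite 1 E
        (expGL (complexPlaceLie 1 w (a' • (1 : Matrix (Fin 1) (Fin 1) ℂ))))) : (AdeleRing (𝓞 E) E)ˣ) :
          AdeleRing (𝓞 E) E).1) (σ⁻¹ • w')) = if w' = σ • w.1 then Complex.exp a' else 1 := by
    intro a' w'
    rw [extensionEmbedding_det_ofInfinite_expGL_complexPlaceLie]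
    have hiff : σ⁻¹ • w' = w.1 ↔ w' = σ • w.1 := by
      constructor
      · intro h; rw [← h, smul_inv_smul]
      · intro h; rw [h, inv_smul_smul]
    by_cases h : w' = σ • w.1
    · rw [if_pos (hiff.2 h), if_pos h]
    · rw [if_neg (fun h' => h (hiff.1 h')), if_neg h]
  -- the coordinates of `σ • y` at `w'`: transport from `σ⁻¹ w'`, uniformly in `y`
  have hsm : ∀ (y : (AdeleRing (𝓞 E) E)ˣ) (w' : InfinitePlace E),
      ((σ • y : (AdeleRing (𝓞 E) E)ˣ) : AdeleRing (𝓞 E) E).1 w' =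
        galInfiniteCompletionMap σ (smul_inv_smul σ w') ((y : AdeleRing (𝓞 E) E).1 (σ⁻¹ • w')) := by
    intro y w'
    rw [AdeleRing.coe_smul_units, AdeleRing.smul_fst, InfiniteAdeleRing.smul_apply]
  rcases ArchHerbrand.extensionEmbedding_galInfiniteCompletionMap σ (smul_inv_smul σ (σ • w.1))
    with hσ | hσ
  · refine Or.inl ⟨fun x => ?_, fun a => idele_eq_of_snd_eq_of_extensionEmbedding_eq E ?_ fun w' => ?_⟩
    · have hx := hσ (x : (σ⁻¹ • σ • w.1).Completion)
      simp only [galInfiniteCompletionMap_coe, ArchHerbrand.extensionEmbedding_coe'] at hx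
      rwa [inv_smul_smul] at hx
    · rw [smul_det_ofInfinite_expGL_snd, det_ofInfinite_snd]
    · rw [extensionEmbedding_det_ofInfinite_expGL_complexPlaceLie]
      dsimp only
      by_cases h : w' = σ • w.1
      · subst h
        rw [hsm, hσ, hcoord]
      · rcases ArchHerbrand.extensionEmbedding_galInfiniteCompletionMap σ (smul_inv_smul σ w') with h' | h'
        · rw [hsm, h', hcoord, if_neg h]
        · rw [hsm, h', hcoord, if_neg h, map_one]
  · refine Or.inr ⟨fun x => ?_, fun a => idele_eq_of_snd_eq_of_extensionEmbedding_eq E ?_ fun w' => ?_⟩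
    · have hx := hσ (x : (σ⁻¹ • σ • w.1).Completion)
      simp only [galInfiniteCompletionMap_coe, ArchHerbrand.extensionEmbedding_coe'] at hx
      rwa [inv_smul_smul] at hx
    · rw [smul_det_ofInfinite_expGL_snd, det_ofInfinite_snd]
    · rw [extensionEmbedding_det_ofInfinite_expGL_complexPlaceLie]
      dsimp only
      by_cases h : w' = σ • w.1
      · subst h
        rw [hsm, hσ, hcoord, if_pos rfl, ← Complex.exp_conj, if_pos rfl]
      · rcases ArchHerbrand.extensionEmbedding_galInfiniteCompletionMap σ (smul_inv_smul σ w') with h' | h'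
        · rw [hsm, h', hcoord, if_neg h, if_neg h]
        · rw [hsm, h', hcoord, if_neg h, map_one, if_neg h]

end Galois

/-! ### The differentials place by place -/

section Identities

variable {F E : Type} [Field F] [NumberField F] [Field E] [NumberField E] [Algebra F E]

/-- `(t r) · 1_w = t · (r · 1_w)` at a real place. [folklore] -/
theorem realPlaceLie_mul_smul_one {K : Type*} [Field K] (w : {w : InfinitePlace K // w.IsReal}) (t r : ℝ) :
    realPlaceLie 1 w ((t * r) • (1 : Matrix (Fin 1) (Fin 1) ℝ)) =
      t • realPlaceLie 1 w (r • (1 : Matrix (Fin 1) (Fin 1) ℝ)) := by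
  rw [mul_smul, map_smul (realPlaceLie 1 w) t]

/-- `(t a)_w = t · a_w` at a complex place (`t` real). [folklore] -/
theorem complexPlaceLie_smul_smul_one {K : Type*} [Field K] (w : {w : InfinitePlace K // w.IsComplex})
    (t : ℝ) (a : ℂ) :
    complexPlaceLie 1 w (((t : ℂ) * a) • (1 : Matrix (Fin 1) (Fin 1) ℂ)) =
      t • complexPlaceLie 1 w (a • (1 : Matrix (Fin 1) (Fin 1) ℂ)) := by
  have h1 : ((t : ℂ) * a) • (1 : Matrix (Fin 1) (Fin 1) ℂ) = t • (a • (1 : Matrix (Fin 1) (Fin 1) ℂ)) := by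
    rw [mul_smul, Complex.coe_smul]
  rw [h1, map_smul (complexPlaceLie 1 w) t]

variable (dP : Matrix (Fin 1) (Fin 1) (mixedSpace E) →ₗ[ℝ] ℂ) (χP : HeckeCharacter E)

omit [NumberField F] in
/-- **Galois transport of the differential at a real place**: if `χ_Π` is `Gal(E/F)`-invariant and
`χ_Π(det(exp Y, 1)) = e^{d_Π(Y)}`, then `d_Π(r · 1_{σ w}) = d_Π(r · 1_w)`
(`smul_det_ofInfinite_expGL_realPlace` and injectivity of `t ↦ e^{tμ}`). [folklore] -/
theorem dP_realPlace_smul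
    (hlink : ∀ Y : Matrix (Fin 1) (Fin 1) (mixedSpace E),
      ((χP (Matrix.GeneralLinearGroup.det (GLn.ofInfinite 1 E (expGL Y))) : ℂˣ) : ℂ) = Complex.exp (dP Y))
    (hinv : ∀ (σ : E ≃ₐ[F] E) (y : (AdeleRing (𝓞 E) E)ˣ), χP (σ • y) = χP y)
    (σ : E ≃ₐ[F] E) (w : {w : InfinitePlace E // w.IsReal}) (r : ℝ) :
    dP (realPlaceLie 1 ⟨σ • w.1, (isReal_smul_iff).2 w.2⟩ (r • (1 : Matrix (Fin 1) (Fin 1) ℝ))) =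
      dP (realPlaceLie 1 w (r • (1 : Matrix (Fin 1) (Fin 1) ℝ))) := by
  refine eq_of_forall_cexp_mul_eq fun t => ?_
  have h := congrArg (fun u : ℂˣ => (u : ℂ))
    (hinv σ (Matrix.GeneralLinearGroup.det (GLn.ofInfinite 1 E
      (expGL (realPlaceLie 1 w ((t * r) • (1 : Matrix (Fin 1) (Fin 1) ℝ)))))))
  rw [smul_det_ofInfinite_expGL_realPlace, hlink, hlink, realPlaceLie_mul_smul_one,
    realPlaceLie_mul_smul_one, map_smul dP t, map_smul dP t, Complex.real_smul,
    Complex.real_smul] at h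
  exact h

omit [NumberField F] in
/-- **Galois transport of the differential at a complex place**: `d_Π(a_{σw}) = d_Π(a_w)` for all
`a`, or `d_Π(ā_{σ w}) = d_Π(a_w)` for all `a`, according as `σ_{σw} ∘ σ = σ_w` or `σ̄_w` on `E`.
[folklore] -/
theorem dP_complexPlace_smul_or
    (hlink : ∀ Y : Matrix (Fin 1) (Fin 1) (mixedSpace E),
      ((χP (Matrix.GeneralLinearGroup.det (GLn.ofInfinite 1 E (expGL Y))) : ℂˣ) : ℂ) = Complex.exp (dP Y))
    (hinv : ∀ (σ : E ≃ₐ[F] E) (y : (AdeleRing (𝓞 E) E)ˣ), χP (σ • y) = χP y)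
    (σ : E ≃ₐ[F] E) (w : {w : InfinitePlace E // w.IsComplex}) :
    ((∀ x : E, (σ • w.1).embedding (σ x) = w.1.embedding x) ∧
      ∀ a : ℂ, dP (complexPlaceLie 1 ⟨σ • w.1, (isComplex_smul_iff).2 w.2⟩
        (a • (1 : Matrix (Fin 1) (Fin 1) ℂ))) = dP (complexPlaceLie 1 w (a • (1 : Matrix (Fin 1) (Fin 1) ℂ)))) ∨
    ((∀ x : E, (σ • w.1).embedding (σ x) = conj (w.1.embedding x)) ∧
      ∀ a : ℂ, dP (complexPlaceLie 1 ⟨σ • w.1, (isComplex_smul_iff).2 w.2⟩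
        (conj a • (1 : Matrix (Fin 1) (Fin 1) ℂ))) = dP (complexPlaceLie 1 w (a • (1 : Matrix (Fin 1) (Fin 1) ℂ)))) := by
  rcases smul_det_ofInfinite_expGL_complexPlace_forall F E σ w with ⟨hemb, hσ⟩ | ⟨hemb, hσ⟩
  · refine Or.inl ⟨hemb, fun a => eq_of_forall_cexp_mul_eq fun t => ?_⟩
    have h := congrArg (fun u : ℂˣ => (u : ℂ))
      (hinv σ (Matrix.GeneralLinearGroup.det (GLn.ofInfinite 1 E
        (expGL (complexPlaceLie 1 w (((t : ℂ) * a) • (1 : Matrix (Fin 1) (Fin 1) ℂ)))))))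
    rw [hσ, hlink, hlink, complexPlaceLie_smul_smul_one, complexPlaceLie_smul_smul_one, map_smul dP t,
      map_smul dP t, Complex.real_smul, Complex.real_smul] at h
    exact h
  · refine Or.inr ⟨hemb, fun a => eq_of_forall_cexp_mul_eq fun t => ?_⟩
    have h := congrArg (fun u : ℂˣ => (u : ℂ))
      (hinv σ (Matrix.GeneralLinearGroup.det (GLn.ofInfinite 1 E
        (expGL (complexPlaceLie 1 w (((t : ℂ) * a) • (1 : Matrix (Fin 1) (Fin 1) ℂ)))))))
    have hconj : conj ((t : ℂ) * a) = (t : ℂ) * conj a := by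
      rw [map_mul, Complex.conj_ofReal]
    rw [hσ, hlink, hlink, hconj, complexPlaceLie_smul_smul_one, complexPlaceLie_smul_smul_one, map_smul dP t,
      map_smul dP t, Complex.real_smul, Complex.real_smul] at h
    exact h

omit [NumberField F] in
/-- **At a complex place over a real one the differential is conjugation invariant**:
`d_Π(ā_w) = d_Π(a_w)` (the decomposition group `{1, c}` of `w` has order `2`,
`isRamified_iff_card_stabilizer_eq_two`, and `c` acts on the exponential ideles of `w` by
conjugation, `smul_det_ofInfinite_expGL_complexPlace_of_ne_one`). Arthur–Clozel (1989), Ch. 1 §7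
(`ξ ∘ N_{ℂ/ℝ}` is conjugation invariant). [cite: ArthurClozelAMS120, Ch. 1 §7] -/
theorem dP_complexPlace_conj_of_isReal_comap [IsGalois F E]
    (hlink : ∀ Y : Matrix (Fin 1) (Fin 1) (mixedSpace E),
      ((χP (Matrix.GeneralLinearGroup.det (GLn.ofInfinite 1 E (expGL Y))) : ℂˣ) : ℂ) = Complex.exp (dP Y))
    (hinv : ∀ (σ : E ≃ₐ[F] E) (y : (AdeleRing (𝓞 E) E)ˣ), χP (σ • y) = χP y)
    (w : {w : InfinitePlace E // w.IsComplex}) (hv : (w.1.comap (algebraMap F E)).IsReal) (a : ℂ) :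
    dP (complexPlaceLie 1 w (conj a • (1 : Matrix (Fin 1) (Fin 1) ℂ))) =
      dP (complexPlaceLie 1 w (a • (1 : Matrix (Fin 1) (Fin 1) ℂ))) := by
  -- a non-trivial element of the decomposition group of `w`
  have hram : w.1.IsRamified F := isRamified_iff.2 ⟨w.2, hv⟩
  have h2 : Nat.card (MulAction.stabilizer (E ≃ₐ[F] E) w.1) = 2 :=
    isRamified_iff_card_stabilizer_eq_two.1 hram
  obtain ⟨c, hc1, -⟩ := (Nat.card_eq_two_iff' (1 : MulAction.stabilizer (E ≃ₐ[F] E) w.1)).1 h2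
  have hc : c.1 • w.1 = w.1 := c.2
  have hc1' : c.1 ≠ 1 := fun h => hc1 (Subtype.ext h)
  refine eq_of_forall_cexp_mul_eq fun t => ?_
  have h := congrArg (fun u : ℂˣ => (u : ℂ))
    (hinv c.1 (Matrix.GeneralLinearGroup.det (GLn.ofInfinite 1 E
      (expGL (complexPlaceLie 1 w (((t : ℂ) * a) • (1 : Matrix (Fin 1) (Fin 1) ℂ)))))))
  have hconj : conj ((t : ℂ) * a) = (t : ℂ) * conj a := by
    rw [map_mul, Complex.conj_ofReal]
  rw [smul_det_ofInfinite_expGL_complexPlace_of_ne_one F E w hc hc1', hlink, hlink, hconj,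
    complexPlaceLie_smul_smul_one, complexPlaceLie_smul_smul_one, map_smul dP t, map_smul dP t,
    Complex.real_smul, Complex.real_smul] at h
  exact h

variable (dπ : Matrix (Fin 1) (Fin 1) (mixedSpace F) →ₗ[ℝ] ℂ) (χπ : HeckeCharacter F)

/-- **The base-change identity at a real place `v` of `F`, summed over the places above**:
`d_Π(y · 1) = [E:F] · d_π(r · 1_v)`, where `y ∈ E_∞` is `r` at the places above `v` and `0`
elsewhere (`ideleBaseChange_det_ofInfinite_expGL_realPlace` and `χ_Π(x_E) = χ_π(x)^{[E:F]}`).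
[folklore] -/
theorem dP_baseChange_realPlace
    (hlinkP : ∀ Y : Matrix (Fin 1) (Fin 1) (mixedSpace E),
      ((χP (Matrix.GeneralLinearGroup.det (GLn.ofInfinite 1 E (expGL Y))) : ℂˣ) : ℂ) = Complex.exp (dP Y))
    (hlinkπ : ∀ Y : Matrix (Fin 1) (Fin 1) (mixedSpace F),
      ((χπ (Matrix.GeneralLinearGroup.det (GLn.ofInfinite 1 F (expGL Y))) : ℂˣ) : ℂ) = Complex.exp (dπ Y))
    (hbcv : ∀ x : (AdeleRing (𝓞 F) F)ˣ,
      χP (AdeleRing.ideleBaseChange F E x) = χπ x ^ Fintype.card (E ≃ₐ[F] E))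
    (v : {v : InfinitePlace F // v.IsReal}) (r : ℝ) :
    dP ((((fun w : {w : InfinitePlace E // w.IsReal} =>
            if w.1.comap (algebraMap F E) = v.1 then r else 0,
          fun w : {w : InfinitePlace E // w.IsComplex} =>
            if w.1.comap (algebraMap F E) = v.1 then (r : ℂ) else 0) : mixedSpace E) •
          (1 : Matrix (Fin 1) (Fin 1) (mixedSpace E)))) =
      (Fintype.card (E ≃ₐ[F] E) : ℂ) * dπ (realPlaceLie 1 v (r • (1 : Matrix (Fin 1) (Fin 1) ℝ))) := by
  refine eq_of_forall_cexp_mul_eq fun t => ?_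
  have h := congrArg (fun u : ℂˣ => (u : ℂ))
    (hbcv (Matrix.GeneralLinearGroup.det (GLn.ofInfinite 1 F
      (expGL (realPlaceLie 1 v ((t * r) • (1 : Matrix (Fin 1) (Fin 1) ℝ)))))))
  rw [ideleBaseChange_det_ofInfinite_expGL_realPlace, hlinkP, Units.val_pow_eq_pow_val, hlinkπ,
    ← Complex.exp_nat_mul, realPlaceLie_mul_smul_one, map_smul dπ t, Complex.real_smul] at h
  -- the element `y_{tr} = t · y_r`
  have hy : (((fun w : {w : InfinitePlace E // w.IsReal} =>
            if w.1.comap (algebraMap F E) = v.1 then t * r else 0,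
          fun w : {w : InfinitePlace E // w.IsComplex} =>
            if w.1.comap (algebraMap F E) = v.1 then ((t * r : ℝ) : ℂ) else 0) : mixedSpace E) •
          (1 : Matrix (Fin 1) (Fin 1) (mixedSpace E))) =
      t • ((((fun w : {w : InfinitePlace E // w.IsReal} =>
            if w.1.comap (algebraMap F E) = v.1 then r else 0,
          fun w : {w : InfinitePlace E // w.IsComplex} =>
            if w.1.comap (algebraMap F E) = v.1 then (r : ℂ) else 0) : mixedSpace E) •
          (1 : Matrix (Fin 1) (Fin 1) (mixedSpace E)))) := by
    rw [← smul_assoc]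
    congr 1
    refine Prod.ext (funext fun w => ?_) (funext fun w => ?_)
    · change (if w.1.comap (algebraMap F E) = v.1 then t * r else 0) =
        t • (if w.1.comap (algebraMap F E) = v.1 then r else 0)
      split_ifs <;> simp
    · change (if w.1.comap (algebraMap F E) = v.1 then ((t * r : ℝ) : ℂ) else 0) =
        t • (if w.1.comap (algebraMap F E) = v.1 then (r : ℂ) else 0)
      split_ifs <;> simp [Complex.ofReal_mul]
  rw [hy, map_smul dP t, Complex.real_smul] at h
  rw [h]
  ring_nf

/-- **The base-change identity at a complex place `v` of `F`, summed over the places above**: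
`d_Π(y · 1) = [E:F] · d_π(b_v)`, where `y ∈ E_∞` is, at `w ∣ v`, `b` or `b̄` according as
`σ_w|_F = σ_v` or `σ̄_v`, and `0` elsewhere (`ideleBaseChange_det_ofInfinite_expGL_complexPlace`).
[folklore] -/
theorem dP_baseChange_complexPlace
    (hlinkP : ∀ Y : Matrix (Fin 1) (Fin 1) (mixedSpace E),
      ((χP (Matrix.GeneralLinearGroup.det (GLn.ofInfinite 1 E (expGL Y))) : ℂˣ) : ℂ) = Complex.exp (dP Y))
    (hlinkπ : ∀ Y : Matrix (Fin 1) (Fin 1) (mixedSpace F),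
      ((χπ (Matrix.GeneralLinearGroup.det (GLn.ofInfinite 1 F (expGL Y))) : ℂˣ) : ℂ) = Complex.exp (dπ Y))
    (hbcv : ∀ x : (AdeleRing (𝓞 F) F)ˣ,
      χP (AdeleRing.ideleBaseChange F E x) = χπ x ^ Fintype.card (E ≃ₐ[F] E))
    (v : {v : InfinitePlace F // v.IsComplex}) (b : ℂ) :
    dP ((((fun _ : {w : InfinitePlace E // w.IsReal} => (0 : ℝ),
          fun w : {w : InfinitePlace E // w.IsComplex} =>
            if w.1.comap (algebraMap F E) = v.1 then
              (if w.1.embedding.comp (algebraMap F E) = v.1.embedding then b else conj b)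
            else 0) : mixedSpace E) • (1 : Matrix (Fin 1) (Fin 1) (mixedSpace E)))) =
      (Fintype.card (E ≃ₐ[F] E) : ℂ) * dπ (complexPlaceLie 1 v (b • (1 : Matrix (Fin 1) (Fin 1) ℂ))) := by
  refine eq_of_forall_cexp_mul_eq fun t => ?_
  have h := congrArg (fun u : ℂˣ => (u : ℂ))
    (hbcv (Matrix.GeneralLinearGroup.det (GLn.ofInfinite 1 F
      (expGL (complexPlaceLie 1 v (((t : ℂ) * b) • (1 : Matrix (Fin 1) (Fin 1) ℂ)))))))
  rw [ideleBaseChange_det_ofInfinite_expGL_complexPlace, hlinkP, Units.val_pow_eq_pow_val, hlinkπ,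
    ← Complex.exp_nat_mul, complexPlaceLie_smul_smul_one, map_smul dπ t, Complex.real_smul] at h
  have hconj : conj ((t : ℂ) * b) = (t : ℂ) * conj b := by rw [map_mul, Complex.conj_ofReal]
  have hy : (((fun _ : {w : InfinitePlace E // w.IsReal} => (0 : ℝ),
          fun w : {w : InfinitePlace E // w.IsComplex} =>
            if w.1.comap (algebraMap F E) = v.1 then
              (if w.1.embedding.comp (algebraMap F E) = v.1.embedding then (t : ℂ) * b
                else conj ((t : ℂ) * b))
            else 0) : mixedSpace E) • (1 : Matrix (Fin 1) (Fin 1) (mixedSpace E))) =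
      t • ((((fun _ : {w : InfinitePlace E // w.IsReal} => (0 : ℝ),
          fun w : {w : InfinitePlace E // w.IsComplex} =>
            if w.1.comap (algebraMap F E) = v.1 then
              (if w.1.embedding.comp (algebraMap F E) = v.1.embedding then b else conj b)
            else 0) : mixedSpace E) • (1 : Matrix (Fin 1) (Fin 1) (mixedSpace E)))) := by
    rw [← smul_assoc]
    congr 1
    refine Prod.ext (funext fun w => ?_) (funext fun w => ?_)
    · change (0 : ℝ) = t • (0 : ℝ)
      rw [smul_zero]
    · change (if w.1.comap (algebraMap F E) = v.1 then
          (if w.1.embedding.comp (algebraMap F E) = v.1.embedding then (t : ℂ) * b else conj ((t : ℂ) * b))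
          else 0) =
        t • (if w.1.comap (algebraMap F E) = v.1 then
          (if w.1.embedding.comp (algebraMap F E) = v.1.embedding then b else conj b) else 0)
      rw [hconj]
      split_ifs <;> simp
  rw [hy, map_smul dP t, Complex.real_smul] at h
  rw [h]
  ring_nf

end Identities

/-! ### Which embedding of `F_v` a place above extends, under Galois transport -/

section Compat

variable (F E : Type) [Field F] [Field E] [Algebra F E]

/-- If `σ_{σw} ∘ σ = σ_w` on `E` then `σ w` and `w` induce the same embedding of `F`, so
`σ_{σw}|_F = σ_v ↔ σ_w|_F = σ_v` (`v = w|_F = (σw)|_F`). [folklore] -/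
theorem embedding_comp_eq_iff_of_smul_eq (σ : E ≃ₐ[F] E) (w : InfinitePlace E)
    (hemb : ∀ x : E, (σ • w).embedding (σ x) = w.embedding x) :
    ((σ • w).embedding.comp (algebraMap F E) = ((σ • w).comap (algebraMap F E)).embedding ↔
      w.embedding.comp (algebraMap F E) = (w.comap (algebraMap F E)).embedding) := by
  have h1 : (σ • w).embedding.comp (algebraMap F E) = w.embedding.comp (algebraMap F E) := by
    refine RingHom.ext fun a => ?_
    rw [RingHom.comp_apply, RingHom.comp_apply, ← hemb (algebraMap F E a), AlgEquiv.commutes]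
  rw [h1, InfinitePlace.comap_algEquiv_smul F σ w]

/-- If `σ_{σw} ∘ σ = σ̄_w` on `E` and `v = w|_F` is complex then exactly one of `σ w`, `w` induces
`σ_v` on `F`: `σ_{σw}|_F = σ_v ↔ σ_w|_F ≠ σ_v`. [folklore] -/
theorem embedding_comp_eq_iff_not_of_smul_eq_conj (σ : E ≃ₐ[F] E) (w : InfinitePlace E)
    (hv : (w.comap (algebraMap F E)).IsComplex)
    (hemb : ∀ x : E, (σ • w).embedding (σ x) = conj (w.embedding x)) :
    ((σ • w).embedding.comp (algebraMap F E) = ((σ • w).comap (algebraMap F E)).embedding ↔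
      ¬ w.embedding.comp (algebraMap F E) = (w.comap (algebraMap F E)).embedding) := by
  have h1 : (σ • w).embedding.comp (algebraMap F E) =
      ComplexEmbedding.conjugate (w.embedding.comp (algebraMap F E)) := by
    refine RingHom.ext fun a => ?_
    rw [RingHom.comp_apply, ComplexEmbedding.conjugate_coe_eq, RingHom.comp_apply,
      ← hemb (algebraMap F E a), AlgEquiv.commutes]
  rw [h1, InfinitePlace.comap_algEquiv_smul F σ w]
  have hne : ComplexEmbedding.conjugate (w.comap (algebraMap F E)).embedding ≠
      (w.comap (algebraMap F E)).embedding := by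
    rw [Ne, ← ComplexEmbedding.isReal_iff]
    exact isComplex_iff.1 hv
  constructor
  · intro h hc
    rw [hc] at h
    exact hne h
  · intro hc
    exact (embedding_comp_eq_or F E w).resolve_left hc

end Compat

/-! ### Counting the places above a place (orbit–stabiliser) -/

section Counting

variable (F E : Type) [Field F] [NumberField F] [Field E] [NumberField E] [Algebra F E]

/-- **Orbit–stabiliser for the places above `v = w₀|_F`**: their number times the order of the
decomposition group of `w₀` is `[E:F]` (`Gal(E/F)` acts transitively on the fibre,
Mathlib `InfinitePlace.mem_orbit_iff`). [folklore] -/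
theorem card_filter_comap_mul_card_stabilizer [IsGalois F E] (w₀ : InfinitePlace E) :
    (Finset.univ.filter fun w : InfinitePlace E =>
        w.comap (algebraMap F E) = w₀.comap (algebraMap F E)).card *
      Nat.card (MulAction.stabilizer (E ≃ₐ[F] E) w₀) = Fintype.card (E ≃ₐ[F] E) := by
  have h1 : (Finset.univ.filter fun w : InfinitePlace E =>
      w.comap (algebraMap F E) = w₀.comap (algebraMap F E)) =
        (MulAction.orbit (E ≃ₐ[F] E) w₀).toFinset := by
    ext w'
    rw [Finset.mem_filter_univ, Set.mem_toFinset, mem_orbit_iff, @eq_comm _ (comap w' _)]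
  rw [h1, Set.toFinset_card, Nat.card_eq_fintype_card]
  convert MulAction.card_orbit_mul_card_stabilizer_eq_card_group (E ≃ₐ[F] E) w₀ using 2

omit [NumberField F] in
/-- The fibre above `w₀|_F` inside a Galois-stable type of places (real, or complex) has the same
cardinality as the full fibre (the fibre is one Galois orbit). [folklore] -/
theorem card_filter_subtype_comap_eq [IsGalois F E] {p : InfinitePlace E → Prop}
    (hp : ∀ (σ : E ≃ₐ[F] E) (w : InfinitePlace E), p w → p (σ • w)) (w₀ : InfinitePlace E)
    (h₀ : p w₀) :
    (Finset.univ.filter fun w : {w : InfinitePlace E // p w} =>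
        w.1.comap (algebraMap F E) = w₀.comap (algebraMap F E)).card =
      (Finset.univ.filter fun w : InfinitePlace E =>
        w.comap (algebraMap F E) = w₀.comap (algebraMap F E)).card := by
  refine Finset.card_bij (fun w _ => w.1) (fun w hw => ?_) (fun w₁ _ w₂ _ h => Subtype.ext h)
    (fun w' hw' => ?_)
  · rw [Finset.mem_filter_univ] at hw ⊢
    exact hw
  · rw [Finset.mem_filter_univ] at hw'
    obtain ⟨σ, hσ⟩ := exists_smul_eq_of_comap_eq hw'.symm
    exact ⟨⟨w', hσ ▸ hp σ w₀ h₀⟩, (Finset.mem_filter_univ _).2 hw', rfl⟩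

/-- Above the restriction of a real place `w₀` of `E` there are exactly `[E:F]` real places.
[folklore] -/
theorem card_filter_isReal_comap_eq [IsGalois F E] (w₀ : {w : InfinitePlace E // w.IsReal}) :
    (Finset.univ.filter fun w : {w : InfinitePlace E // w.IsReal} =>
        w.1.comap (algebraMap F E) = w₀.1.comap (algebraMap F E)).card = Fintype.card (E ≃ₐ[F] E) := by
  have h1 := card_filter_comap_mul_card_stabilizer F E w₀.1
  rw [isUnramified_iff_card_stabilizer_eq_one.1 (IsReal.isUnramified F w₀.2), mul_one] at h1
  rw [card_filter_subtype_comap_eq F E (fun σ w h => isReal_smul_iff.2 h) w₀.1 w₀.2]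
  exact h1

/-- Above the restriction `v` of a complex place `w₀` of `E` with `v` real there are exactly
`[E:F]/2` complex places. [folklore] -/
theorem two_mul_card_filter_isComplex_comap_eq [IsGalois F E]
    (w₀ : {w : InfinitePlace E // w.IsComplex}) (hv : (w₀.1.comap (algebraMap F E)).IsReal) :
    2 * (Finset.univ.filter fun w : {w : InfinitePlace E // w.IsComplex} =>
        w.1.comap (algebraMap F E) = w₀.1.comap (algebraMap F E)).card = Fintype.card (E ≃ₐ[F] E) := by
  have h1 := card_filter_comap_mul_card_stabilizer F E w₀.1
  rw [isRamified_iff_card_stabilizer_eq_two.1 (isRamified_iff.2 ⟨w₀.2, hv⟩)] at h1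
  rw [card_filter_subtype_comap_eq F E (fun σ w h => isComplex_smul_iff.2 h) w₀.1 w₀.2, mul_comm]
  exact h1

/-- Above the restriction `v` of a complex place `w₀` of `E` with `v` complex there are exactly
`[E:F]` (complex) places. [folklore] -/
theorem card_filter_isComplex_comap_eq [IsGalois F E]
    (w₀ : {w : InfinitePlace E // w.IsComplex}) (hv : (w₀.1.comap (algebraMap F E)).IsComplex) :
    (Finset.univ.filter fun w : {w : InfinitePlace E // w.IsComplex} =>
        w.1.comap (algebraMap F E) = w₀.1.comap (algebraMap F E)).card = Fintype.card (E ≃ₐ[F] E) := by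
  have h1 := card_filter_comap_mul_card_stabilizer F E w₀.1
  rw [isUnramified_iff_card_stabilizer_eq_one.1 (isUnramified_iff.2 (Or.inr hv)), mul_one] at h1
  rw [card_filter_subtype_comap_eq F E (fun σ w h => isComplex_smul_iff.2 h) w₀.1 w₀.2]
  exact h1

end Counting

/-! ### Decomposition of `y · 1` along the places -/

section Decomposition

variable {E : Type} [Field E] [NumberField E]

/-- `y · 1 = Σ_{w real} (y_w) · 1_w + Σ_{w complex} (y_w)_w` in `M₁(E_∞)`. [folklore] -/
theorem smul_one_eq_sum_placeLie (y : mixedSpace E) :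
    y • (1 : Matrix (Fin 1) (Fin 1) (mixedSpace E)) =
      ∑ w : {w : InfinitePlace E // w.IsReal}, realPlaceLie 1 w (y.1 w • (1 : Matrix (Fin 1) (Fin 1) ℝ)) +
        ∑ w : {w : InfinitePlace E // w.IsComplex},
          complexPlaceLie 1 w (y.2 w • (1 : Matrix (Fin 1) (Fin 1) ℂ)) := by
  refine Matrix.ext fun i j => ?_
  rw [Subsingleton.elim i 0, Subsingleton.elim j 0, smul_one_matrix_apply, Matrix.add_apply,
    Matrix.sum_apply, Matrix.sum_apply]
  simp only [realPlaceLie_smul_one_apply, complexPlaceLie_smul_one_apply]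
  refine Prod.ext (funext fun w => ?_) (funext fun w => ?_)
  · simp only [Prod.fst_add, Prod.fst_sum, Pi.add_apply, Finset.sum_apply, Finset.sum_pi_single,
      Finset.mem_univ, if_true, Pi.zero_apply, Finset.sum_const_zero, add_zero]
  · simp only [Prod.snd_add, Prod.snd_sum, Pi.add_apply, Finset.sum_apply, Finset.sum_pi_single,
      Finset.mem_univ, if_true, Pi.zero_apply, Finset.sum_const_zero, zero_add]

/-- A real-linear functional on `M₁(E_∞)` evaluated on `y · 1`, place by place. [folklore] -/
theorem linearMap_smul_one_eq_sum (d : Matrix (Fin 1) (Fin 1) (mixedSpace E) →ₗ[ℝ] ℂ) (y : mixedSpace E) :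
    d (y • (1 : Matrix (Fin 1) (Fin 1) (mixedSpace E))) =
      ∑ w : {w : InfinitePlace E // w.IsReal}, d (realPlaceLie 1 w (y.1 w • (1 : Matrix (Fin 1) (Fin 1) ℝ))) +
        ∑ w : {w : InfinitePlace E // w.IsComplex},
          d (complexPlaceLie 1 w (y.2 w • (1 : Matrix (Fin 1) (Fin 1) ℂ))) := by
  rw [smul_one_eq_sum_placeLie, map_add, map_sum, map_sum]

end Decomposition

/-! ### The place-by-place identities -/

section Final

variable {F E : Type} [Field F] [NumberField F] [Field E] [NumberField E] [Algebra F E]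
variable (dP : Matrix (Fin 1) (Fin 1) (mixedSpace E) →ₗ[ℝ] ℂ) (χP : HeckeCharacter E)
variable (dπ : Matrix (Fin 1) (Fin 1) (mixedSpace F) →ₗ[ℝ] ℂ) (χπ : HeckeCharacter F)

/-- **Real place above a real place: `d_Π(r · 1_w) = d_π(r · 1_v)`** (`v = w|_F`). The `[E:F]` real
places above `v` contribute equally (Galois transport) to `d_Π((r·1_v)_E) = [E:F] d_π(r · 1_v)`.
This is `χ_{Π,w} = χ_{π,v} ∘ N_{E_w/F_v}` with `E_w = F_v = ℝ`. Arthur–Clozel (1989), Ch. 3,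
proof of Thm. 5.1 (case `n = 1`), p. 214; Ch. 1 §6.2. [cite: ArthurClozelAMS120, Ch. 3 Thm 5.1] -/
theorem dP_realPlaceLie_eq [IsGalois F E]
    (hlinkP : ∀ Y : Matrix (Fin 1) (Fin 1) (mixedSpace E),
      ((χP (Matrix.GeneralLinearGroup.det (GLn.ofInfinite 1 E (expGL Y))) : ℂˣ) : ℂ) = Complex.exp (dP Y))
    (hlinkπ : ∀ Y : Matrix (Fin 1) (Fin 1) (mixedSpace F),
      ((χπ (Matrix.GeneralLinearGroup.det (GLn.ofInfinite 1 F (expGL Y))) : ℂˣ) : ℂ) = Complex.exp (dπ Y))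
    (hinv : ∀ (σ : E ≃ₐ[F] E) (y : (AdeleRing (𝓞 E) E)ˣ), χP (σ • y) = χP y)
    (hbcv : ∀ x : (AdeleRing (𝓞 F) F)ˣ,
      χP (AdeleRing.ideleBaseChange F E x) = χπ x ^ Fintype.card (E ≃ₐ[F] E))
    (v : {v : InfinitePlace F // v.IsReal}) (w₀ : {w : InfinitePlace E // w.IsReal})
    (hw₀ : w₀.1.comap (algebraMap F E) = v.1) (r : ℝ) :
    dP (realPlaceLie 1 w₀ (r • (1 : Matrix (Fin 1) (Fin 1) ℝ))) =
      dπ (realPlaceLie 1 v (r • (1 : Matrix (Fin 1) (Fin 1) ℝ))) := by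
  have hBC := dP_baseChange_realPlace dP χP dπ χπ hlinkP hlinkπ hbcv v r
  rw [linearMap_smul_one_eq_sum] at hBC
  dsimp only at hBC
  -- no complex place of `E` lies above `v`
  have hC : ∑ w : {w : InfinitePlace E // w.IsComplex}, dP (complexPlaceLie 1 w
      ((if w.1.comap (algebraMap F E) = v.1 then (r : ℂ) else 0) • (1 : Matrix (Fin 1) (Fin 1) ℂ))) = 0 := by
    refine Finset.sum_eq_zero fun w _ => ?_
    have hw : ¬ w.1.comap (algebraMap F E) = v.1 := by
      intro h
      obtain ⟨σ, hσ⟩ := exists_smul_eq_of_comap_eq (k := F) (h.trans hw₀.symm)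
      have hreal : w.1.IsReal := by
        rw [← isReal_smul_iff (σ := σ), hσ]
        exact w₀.2
      exact not_isReal_iff_isComplex.2 w.2 hreal
    rw [if_neg hw, zero_smul, map_zero, map_zero]
  -- every real place above `v` contributes `d_Π(r · 1_{w₀})`
  have hR : ∑ w : {w : InfinitePlace E // w.IsReal}, dP (realPlaceLie 1 w
      ((if w.1.comap (algebraMap F E) = v.1 then r else 0) • (1 : Matrix (Fin 1) (Fin 1) ℝ))) =
      ∑ w ∈ Finset.univ.filter (fun w : {w : InfinitePlace E // w.IsReal} =>
          w.1.comap (algebraMap F E) = w₀.1.comap (algebraMap F E)),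
        dP (realPlaceLie 1 w₀ (r • (1 : Matrix (Fin 1) (Fin 1) ℝ))) := by
    rw [Finset.sum_filter]
    refine Finset.sum_congr rfl fun w _ => ?_
    rw [hw₀]
    by_cases h : w.1.comap (algebraMap F E) = v.1
    · rw [if_pos h, if_pos h]
      obtain ⟨σ, hσ⟩ := exists_smul_eq_of_comap_eq (k := F) (hw₀.trans h.symm)
      have hw : w = ⟨σ • w₀.1, isReal_smul_iff.2 w₀.2⟩ := Subtype.ext hσ.symm
      rw [hw]
      exact dP_realPlace_smul dP χP hlinkP hinv σ w₀ r
    · rw [if_neg h, if_neg h, zero_smul, map_zero, map_zero]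
  rw [hC, add_zero, hR, Finset.sum_const, nsmul_eq_mul, card_filter_isReal_comap_eq F E w₀] at hBC
  have hℓ : (Fintype.card (E ≃ₐ[F] E) : ℂ) ≠ 0 := Nat.cast_ne_zero.2 Fintype.card_ne_zero
  exact mul_left_cancel₀ hℓ hBC

/-- **Complex place above a real place: `d_Π(r_w) = 2 d_π(r · 1_v)` for real `r`** (`v = w|_F`).
The `[E:F]/2` complex places above `v` contribute equally to `d_Π((r·1_v)_E) = [E:F] d_π(r·1_v)`.
This is `χ_{Π,w} = χ_{π,v} ∘ N_{ℂ/ℝ}` on `ℝ_{>0} ⊆ ℂ^×` (`N(e^r) = e^{2r}`). Arthur–Clozel (1989),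
Ch. 3, proof of Thm. 5.1 (case `n = 1`), p. 214; Ch. 1 §7, pp. 71–72.
[cite: ArthurClozelAMS120, Ch. 3 Thm 5.1] -/
theorem dP_complexPlaceLie_ofReal_eq [IsGalois F E]
    (hlinkP : ∀ Y : Matrix (Fin 1) (Fin 1) (mixedSpace E),
      ((χP (Matrix.GeneralLinearGroup.det (GLn.ofInfinite 1 E (expGL Y))) : ℂˣ) : ℂ) = Complex.exp (dP Y))
    (hlinkπ : ∀ Y : Matrix (Fin 1) (Fin 1) (mixedSpace F),
      ((χπ (Matrix.GeneralLinearGroup.det (GLn.ofInfinite 1 F (expGL Y))) : ℂˣ) : ℂ) = Complex.exp (dπ Y))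
    (hinv : ∀ (σ : E ≃ₐ[F] E) (y : (AdeleRing (𝓞 E) E)ˣ), χP (σ • y) = χP y)
    (hbcv : ∀ x : (AdeleRing (𝓞 F) F)ˣ,
      χP (AdeleRing.ideleBaseChange F E x) = χπ x ^ Fintype.card (E ≃ₐ[F] E))
    (v : {v : InfinitePlace F // v.IsReal}) (w₀ : {w : InfinitePlace E // w.IsComplex})
    (hw₀ : w₀.1.comap (algebraMap F E) = v.1) (r : ℝ) :
    dP (complexPlaceLie 1 w₀ ((r : ℂ) • (1 : Matrix (Fin 1) (Fin 1) ℂ))) =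
      2 * dπ (realPlaceLie 1 v (r • (1 : Matrix (Fin 1) (Fin 1) ℝ))) := by
  have hBC := dP_baseChange_realPlace dP χP dπ χπ hlinkP hlinkπ hbcv v r
  rw [linearMap_smul_one_eq_sum] at hBC
  dsimp only at hBC
  -- no real place of `E` lies above `v`
  have hR : ∑ w : {w : InfinitePlace E // w.IsReal}, dP (realPlaceLie 1 w
      ((if w.1.comap (algebraMap F E) = v.1 then r else 0) • (1 : Matrix (Fin 1) (Fin 1) ℝ))) = 0 := by
    refine Finset.sum_eq_zero fun w _ => ?_
    have hw : ¬ w.1.comap (algebraMap F E) = v.1 := by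
      intro h
      obtain ⟨σ, hσ⟩ := exists_smul_eq_of_comap_eq (k := F) (h.trans hw₀.symm)
      have hreal : w₀.1.IsReal := by
        rw [← hσ]
        exact isReal_smul_iff.2 w.2
      exact not_isReal_iff_isComplex.2 w₀.2 hreal
    rw [if_neg hw, zero_smul, map_zero, map_zero]
  -- every complex place above `v` contributes `d_Π(r_{w₀})`
  have hC : ∑ w : {w : InfinitePlace E // w.IsComplex}, dP (complexPlaceLie 1 w
      ((if w.1.comap (algebraMap F E) = v.1 then (r : ℂ) else 0) • (1 : Matrix (Fin 1) (Fin 1) ℂ))) =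
      ∑ w ∈ Finset.univ.filter (fun w : {w : InfinitePlace E // w.IsComplex} =>
          w.1.comap (algebraMap F E) = w₀.1.comap (algebraMap F E)),
        dP (complexPlaceLie 1 w₀ ((r : ℂ) • (1 : Matrix (Fin 1) (Fin 1) ℂ))) := by
    rw [Finset.sum_filter]
    refine Finset.sum_congr rfl fun w _ => ?_
    rw [hw₀]
    by_cases h : w.1.comap (algebraMap F E) = v.1
    · rw [if_pos h, if_pos h]
      obtain ⟨σ, hσ⟩ := exists_smul_eq_of_comap_eq (k := F) (hw₀.trans h.symm)
      have hw : w = ⟨σ • w₀.1, isComplex_smul_iff.2 w₀.2⟩ := Subtype.ext hσ.symm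
      rw [hw]
      rcases dP_complexPlace_smul_or dP χP hlinkP hinv σ w₀ with ⟨-, hA⟩ | ⟨-, hB⟩
      · exact hA r
      · rw [← hB r, Complex.conj_ofReal]
    · rw [if_neg h, if_neg h, zero_smul, map_zero, map_zero]
  rw [hR, zero_add, hC, Finset.sum_const, nsmul_eq_mul] at hBC
  have hcard := two_mul_card_filter_isComplex_comap_eq F E w₀ (by rw [hw₀]; exact v.2)
  have hℓ : (Fintype.card (E ≃ₐ[F] E) : ℂ) ≠ 0 := Nat.cast_ne_zero.2 Fintype.card_ne_zero
  refine mul_left_cancel₀ hℓ ?_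
  calc (Fintype.card (E ≃ₐ[F] E) : ℂ) * dP (complexPlaceLie 1 w₀ ((r : ℂ) • (1 : Matrix (Fin 1) (Fin 1) ℂ)))
        = 2 * (((Finset.univ.filter fun w : {w : InfinitePlace E // w.IsComplex} =>
            w.1.comap (algebraMap F E) = w₀.1.comap (algebraMap F E)).card : ℂ) *
            dP (complexPlaceLie 1 w₀ ((r : ℂ) • (1 : Matrix (Fin 1) (Fin 1) ℂ)))) := by
          rw [← hcard]
          push_cast
          ring
    _ = 2 * ((Fintype.card (E ≃ₐ[F] E) : ℂ) * dπ (realPlaceLie 1 v (r • (1 : Matrix (Fin 1) (Fin 1) ℝ)))) := by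
          rw [hBC]
    _ = (Fintype.card (E ≃ₐ[F] E) : ℂ) * (2 * dπ (realPlaceLie 1 v (r • (1 : Matrix (Fin 1) (Fin 1) ℝ)))) := by
          ring

/-- **Complex place above a complex place: `d_Π(b_w) = d_π(b_v)` if `σ_w|_F = σ_v`, and
`d_Π(b̄_w) = d_π(b_v)` otherwise** (`v = w|_F`; the `[E:F]` places above `v` contribute equally,
the conjugations being tracked by `embedding_comp_eq_iff_of_smul_eq` /
`embedding_comp_eq_iff_not_of_smul_eq_conj`). This is `χ_{Π,w} = χ_{π,v} ∘ N_{E_w/F_v}` with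
`E_w = F_v = ℂ` (identified through `σ_w`, `σ_v`). Arthur–Clozel (1989), Ch. 3, proof of Thm. 5.1
(case `n = 1`), p. 214; Ch. 1 §6.2. [cite: ArthurClozelAMS120, Ch. 3 Thm 5.1] -/
theorem dP_complexPlaceLie_eq_of_isComplex [IsGalois F E]
    (hlinkP : ∀ Y : Matrix (Fin 1) (Fin 1) (mixedSpace E),
      ((χP (Matrix.GeneralLinearGroup.det (GLn.ofInfinite 1 E (expGL Y))) : ℂˣ) : ℂ) = Complex.exp (dP Y))
    (hlinkπ : ∀ Y : Matrix (Fin 1) (Fin 1) (mixedSpace F),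
      ((χπ (Matrix.GeneralLinearGroup.det (GLn.ofInfinite 1 F (expGL Y))) : ℂˣ) : ℂ) = Complex.exp (dπ Y))
    (hinv : ∀ (σ : E ≃ₐ[F] E) (y : (AdeleRing (𝓞 E) E)ˣ), χP (σ • y) = χP y)
    (hbcv : ∀ x : (AdeleRing (𝓞 F) F)ˣ,
      χP (AdeleRing.ideleBaseChange F E x) = χπ x ^ Fintype.card (E ≃ₐ[F] E))
    (v : {v : InfinitePlace F // v.IsComplex}) (w₀ : {w : InfinitePlace E // w.IsComplex})
    (hw₀ : w₀.1.comap (algebraMap F E) = v.1) (b : ℂ) :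
    dP (complexPlaceLie 1 w₀
        ((if w₀.1.embedding.comp (algebraMap F E) = v.1.embedding then b else conj b) •
          (1 : Matrix (Fin 1) (Fin 1) ℂ))) =
      dπ (complexPlaceLie 1 v (b • (1 : Matrix (Fin 1) (Fin 1) ℂ))) := by
  have hBC := dP_baseChange_complexPlace dP χP dπ χπ hlinkP hlinkπ hbcv v b
  rw [linearMap_smul_one_eq_sum] at hBC
  dsimp only at hBC
  have hvc : (w₀.1.comap (algebraMap F E)).IsComplex := by
    rw [hw₀]
    exact v.2
  have hR : ∑ w : {w : InfinitePlace E // w.IsReal}, dP (realPlaceLie 1 w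
      ((0 : ℝ) • (1 : Matrix (Fin 1) (Fin 1) ℝ))) = 0 :=
    Finset.sum_eq_zero fun w _ => by rw [zero_smul, map_zero, map_zero]
  -- every place above `v` contributes `d_Π` of the `w₀` coordinate
  have hC : ∑ w : {w : InfinitePlace E // w.IsComplex}, dP (complexPlaceLie 1 w
      ((if w.1.comap (algebraMap F E) = v.1 then
          (if w.1.embedding.comp (algebraMap F E) = v.1.embedding then b else conj b) else 0) •
        (1 : Matrix (Fin 1) (Fin 1) ℂ))) =
      ∑ w ∈ Finset.univ.filter (fun w : {w : InfinitePlace E // w.IsComplex} =>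
          w.1.comap (algebraMap F E) = w₀.1.comap (algebraMap F E)),
        dP (complexPlaceLie 1 w₀
          ((if w₀.1.embedding.comp (algebraMap F E) = v.1.embedding then b else conj b) •
            (1 : Matrix (Fin 1) (Fin 1) ℂ))) := by
    rw [Finset.sum_filter]
    refine Finset.sum_congr rfl fun w _ => ?_
    rw [hw₀]
    by_cases h : w.1.comap (algebraMap F E) = v.1
    · rw [if_pos h, if_pos h]
      obtain ⟨σ, hσ⟩ := exists_smul_eq_of_comap_eq (k := F) (hw₀.trans h.symm)
      have hw : w = ⟨σ • w₀.1, isComplex_smul_iff.2 w₀.2⟩ := Subtype.ext hσ.symm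
      rw [hw]
      dsimp only
      rcases dP_complexPlace_smul_or dP χP hlinkP hinv σ w₀ with ⟨hemb, hA⟩ | ⟨hemb, hB⟩
      · have hiff := embedding_comp_eq_iff_of_smul_eq F E σ w₀.1 hemb
        rw [InfinitePlace.comap_algEquiv_smul F σ w₀.1, hw₀] at hiff
        by_cases hc : w₀.1.embedding.comp (algebraMap F E) = v.1.embedding
        · rw [if_pos (hiff.2 hc), if_pos hc]
          exact hA b
        · rw [if_neg (fun h' => hc (hiff.1 h')), if_neg hc]
          exact hA (conj b)
      · have hiff := embedding_comp_eq_iff_not_of_smul_eq_conj F E σ w₀.1 hvc hemb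
        rw [InfinitePlace.comap_algEquiv_smul F σ w₀.1, hw₀] at hiff
        by_cases hc : w₀.1.embedding.comp (algebraMap F E) = v.1.embedding
        · rw [if_neg (fun h' => hiff.1 h' hc), if_pos hc]
          exact hB b
        · rw [if_pos (hiff.2 hc), if_neg hc]
          have h' := hB (conj b)
          rwa [Complex.conj_conj] at h'
    · rw [if_neg h, if_neg h, zero_smul, map_zero, map_zero]
  rw [hR, zero_add, hC, Finset.sum_const, nsmul_eq_mul, card_filter_isComplex_comap_eq F E w₀ hvc]
    at hBC
  have hℓ : (Fintype.card (E ≃ₐ[F] E) : ℂ) ≠ 0 := Nat.cast_ne_zero.2 Fintype.card_ne_zero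
  exact mul_left_cancel₀ hℓ hBC

end Final

end Literature.NumberTheory.Automorphic
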